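import Mathlib
import Literature.Analysis.ValidatedNumerics.WeightedEllOneSequenceAlgebra
import HarnessLib

/-!
# Weighted `ℓ¹` kernel operators: composition, the `Z₁` kernel `I − A·M` and the far-column lemma

This file (with its sequel `WeightedEllOneTailBounds.lean`) is the soundness layer UNDER the
`Z`-bound bookkeeping of a coefficient-space ("radii polynomial") certificate in a weighted `ℓ¹`
space `ℓ¹_ω` over a general index `ι` (vocabulary of
`Literature.Analysis.ValidatedNumerics.WeightedSeq`, file `WeightedEllOneSequenceAlgebra.lean`:
`wnorm`, `Mem`, `ColBound`, `apply`, `blockDiag`).  Such a certificate closes with a contraction /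
Newton–Kantorovich theorem whose hypothesis is an operator-norm bound `‖I − A·M‖ ≤ Z`
(`M = DF(x̄)` or `A†`; `A = A_K ⊕ diag(d)` a finite block and a diagonal tail), and the number `Z`
is obtained column by column: finitely many columns are evaluated exactly, the remaining ("far")
columns are bounded by a tail estimate.  The statements below make each step a theorem:

1. **Composition** (`kerComp`, `colBound_kerComp`, `apply_kerComp`): the kernel of the composite
   of two kernel operators, its weighted column bound `C₂·C₁` (Tonelli), and — under the column
   bounds, by Fubini — `T_{M ∘ₖ N} = T_M ∘ T_N` on `ℓ¹_ω`.
2. **The `Z₁` kernel** `oneSubKer A M = id − kerComp A M`: `apply_oneSubKer`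
   (`T s = s − T_A (T_M s)`) and `wnorm_sub_apply_apply_le` (a column bound `Z` of this kernel IS
   the estimate `‖s − A(M s)‖_ω ≤ Z ‖s‖_ω` that the closing theorems consume).
3. **Block-diagonal left factor and far columns**: `kerComp_blockDiag` (explicit rows of `A·M`),
   `kerComp_blockDiag_of_col_vanish` (a column of `M` vanishing on the block rows is never seen by
   the block: "the diagonal tail of `I − AA†` is zero", [HungriaLessardMirelesJames2016, p. 1453]),
   and the **far-column lemma** `far_column_tsum_le`: if moreover `M(k,m) = μ[k=m] + R(k,m)` off
   the block with `d(m) μ = 1` (the tail of `A` inverts the symbol of the column) and `|d(k)| ≤ δ`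
   on the support of `R(·,m)`, then `Σ_k |(I − A·M)(k,m)| ω(k) ≤ δ · Σ_k |R(k,m)| ω(k) ≤ δ C_R ω(m)`.
   `colBound_of_split` assembles `ColBound … Z` from an enumerated finite set of columns (checked
   one by one, `col_tsum_of_support`) and a uniform bound on the others.

## Sources and verbatim statements

* [HungriaLessardMirelesJames2016] A. Hungria, J.-P. Lessard, J. D. Mireles James, *Rigorous
  numerics for analytic solutions of differential equations: the radii polynomial approach*,
  Math. Comp. 85 (2016) 1427–1459.  Corollary 1, p. 1434: for `A` acting by a finite block
  `A^{(m)}` on the modes `|k| < m` and by `δ_k a_k` (`|δ_k| ≤ δ`) on `|k| ≥ m`,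
  "`A ∈ B(ℓ¹_ν, ℓ¹_ν)` and `‖A‖_{B(ℓ¹_ν,ℓ¹_ν)} ≤ max(K, δ)`, where
  `K = max_{|n|<m} ν^{-|n|} Σ_{|k|<m} |A_{k,n}| ν^{|k|}`" (in the tree: `colBound_blockDiag`);
  §5.2, p. 1453: "`DT(ā + b)c = [I − A DF(ā + b)]c = [I − AA†]c − A[DF(ā + b)c − A†c]` (5.13) …
  `Z^{(0)} = max_{0≤n≤m−1} (1/ν^n) Σ_{ℓ=0}^{m−1} |I − A_m DF^{(m)}(ā)|_{ℓ,n} ν^ℓ` (5.14).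
  By definition of the diagonal tails of `A` and `A†`, the diagonal tail of `I − AA†` is zero.
  Hence, by Corollary 1 `‖[I − AA†]c‖_ν ≤ Z^{(0)} r`."; p. 1454: the tail rows `k ≥ m` of
  `A[DF(ā+b)c − A†c]` are bounded by "`sup_{‖v‖_ν ≤ 1} 3 Σ_{k≥m} [ā²v]_k ν^k / |μ_m|`", i.e. by
  `1/|μ_m|` times the norm of the lower-order (multiplication) operator — the instance of
  `far_column_tsum_le` with one column class and `δ = 1/|μ_m|`.

## What is NOT here (scope)

* No Banach-space (`ContinuousLinearMap`) packaging of kernel operators: as in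
  `WeightedEllOneSequenceAlgebra.lean`, `ℓ¹_ω` is handled through `Mem`/`wnorm`; the closing
  theorems (`RadiiPolynomial*.lean`, `Computation/Certificates/RadiiPolynomialCertificate.lean`)
  take `‖I − A·M‖ ≤ Z` as a hypothesis, and this file certifies the NUMBER `Z` from kernel data.
* No floating-point / interval model: an implementation's exact or outward-rounded column sums
  enter through the `∀ m ∈ T` hypotheses of `colBound_of_split`.  Closed forms (far-column
  factor, certified suprema, weight transfer) are in the sequel `WeightedEllOneTailBounds.lean`.

## Provenance

AI-produced formalisation (cell certnum, seat certnum-lean-3, 2026-08-27): the typed soundness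
layer under step (6) `Z ≥ ‖I − A·DF̂‖` of `pub/certnum/ode/F2-ROUTE-A.md` §4 (A″); all PROVED.
-/

set_option autoImplicit false

open scoped BigOperators ENNReal NNReal
open Finset

noncomputable section

namespace Literature.Analysis.ValidatedNumerics.WeightedSeq

variable {ι ι' ι'' : Type*}

/-! ### 0. Bridge helpers (`ℝ≥0∞` ↔ `ℝ`) -/

section Bridge

/-- [folklore] -/
private theorem ofReal_abs_tsum_le' {α : Type*} (f : α → ℝ) :
    ENNReal.ofReal |∑' i, f i| ≤ ∑' i, ENNReal.ofReal |f i| := by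
  by_cases hf : Summable f
  · have habs : Summable fun i => |f i| := hf.abs
    calc ENNReal.ofReal |∑' i, f i| ≤ ENNReal.ofReal (∑' i, |f i|) := by
          apply ENNReal.ofReal_le_ofReal
          have h := norm_tsum_le_tsum_norm (f := f) (by simpa [Real.norm_eq_abs] using habs)
          simpa [Real.norm_eq_abs] using h
      _ = ∑' i, ENNReal.ofReal |f i| :=
          ENNReal.ofReal_tsum_of_nonneg (fun i => abs_nonneg _) habs
  · simp [tsum_eq_zero_of_not_summable hf]

/-- [folklore] -/
private theorem summable_of_tsum_ofReal_ne_top' {α : Type*} {g : α → ℝ} (hg : ∀ i, 0 ≤ g i)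
    (h : (∑' i, ENNReal.ofReal (g i)) ≠ ∞) : Summable g := by
  have h' : Summable fun i => ((g i).toNNReal : ℝ) :=
    ENNReal.tsum_coe_ne_top_iff_summable_coe.1 (by simpa [ENNReal.ofReal] using h)
  exact h'.congr fun i => Real.coe_toNNReal _ (hg i)

/-- Real form of one column of a column bound (series converges, sum `≤ C ω(m)`). [folklore] -/
private theorem col_summable_and_le {ω : ι → ℝ} {ω' : ι' → ℝ} (hω' : ∀ j, 0 ≤ ω' j)
    {N : ι' → ι → ℝ} {C : ℝ} (hN : ColBound ω ω' N C) (m : ι) (h0 : 0 ≤ C * ω m) :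
    (Summable fun j => |N j m| * ω' j) ∧ ∑' j, |N j m| * ω' j ≤ C * ω m := by
  have hnn : ∀ j, 0 ≤ |N j m| * ω' j := fun j => mul_nonneg (abs_nonneg _) (hω' j)
  have hne : (∑' j, ENNReal.ofReal (|N j m| * ω' j)) ≠ ∞ :=
    ne_top_of_le_ne_top ENNReal.ofReal_ne_top (hN m)
  have hs : Summable fun j => |N j m| * ω' j := summable_of_tsum_ofReal_ne_top' hnn hne
  refine ⟨hs, ?_⟩
  have h1 := hN m
  rw [← ENNReal.ofReal_tsum_of_nonneg hnn hs] at h1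
  exact (ENNReal.ofReal_le_ofReal_iff h0).1 h1

end Bridge

/-! ### 1. Composition of kernel operators -/

section Composition

variable {ω : ι → ℝ} {ω' : ι' → ℝ} {ω'' : ι'' → ℝ}

/-- The kernel of the composite operator `T_M ∘ T_N`:
`(M ∘ₖ N)(k,m) = Σ_j M(k,j) N(j,m)` (a series over the middle index; it converges absolutely under
the column bounds of `colBound_kerComp`, and `apply_kerComp` identifies `T_{M ∘ₖ N} = T_M ∘ T_N`).
This is the object whose columns a `Z`-bound `‖I − A·M‖ ≤ Z` is computed from.
[cite: HungriaLessardMirelesJames2016, §5.2 (5.13)–(5.14) p. 1453] -/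
def kerComp (M : ι'' → ι' → ℝ) (N : ι' → ι → ℝ) (k : ι'') (m : ι) : ℝ := ∑' j, M k j * N j m

/-- **Column bound of a composite**: if `N : ℓ¹_ω → ℓ¹_{ω'}` has weighted column bound `C₁` and
`M : ℓ¹_{ω'} → ℓ¹_{ω''}` has weighted column bound `C₂`, then the composite kernel has column
bound `C₂ C₁` (Tonelli; no summability side condition).  With `wnorm_apply_le` this is
`‖T_M T_N‖ ≤ C₂ C₁`. [cite: HungriaLessardMirelesJames2016, Cor. 1 p. 1434] -/
theorem colBound_kerComp (hω'' : ∀ k, 0 ≤ ω'' k) {M : ι'' → ι' → ℝ} {N : ι' → ι → ℝ}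
    {C₁ C₂ : ℝ} (hC₂ : 0 ≤ C₂) (hN : ColBound ω ω' N C₁) (hM : ColBound ω' ω'' M C₂) :
    ColBound ω ω'' (kerComp M N) (C₂ * C₁) := by
  intro m
  have h1 : ∀ k, ENNReal.ofReal (|kerComp M N k m| * ω'' k) ≤
      ∑' j, ENNReal.ofReal |N j m| * ENNReal.ofReal (|M k j| * ω'' k) := by
    intro k
    have hk : 0 ≤ ω'' k := hω'' k
    have e1 : |kerComp M N k m| * ω'' k = |∑' j, M k j * N j m * ω'' k| := by
      rw [kerComp, tsum_mul_right, abs_mul _ (ω'' k), abs_of_nonneg hk]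
    rw [e1]
    refine (ofReal_abs_tsum_le' _).trans (ENNReal.tsum_le_tsum fun j => le_of_eq ?_)
    rw [← ENNReal.ofReal_mul (abs_nonneg _), abs_mul, abs_mul, abs_of_nonneg hk]
    congr 1; ring
  calc ∑' k, ENNReal.ofReal (|kerComp M N k m| * ω'' k)
      ≤ ∑' k, ∑' j, ENNReal.ofReal |N j m| * ENNReal.ofReal (|M k j| * ω'' k) :=
        ENNReal.tsum_le_tsum h1
    _ = ∑' j, ∑' k, ENNReal.ofReal |N j m| * ENNReal.ofReal (|M k j| * ω'' k) :=
        ENNReal.tsum_comm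
    _ = ∑' j, ENNReal.ofReal |N j m| * ∑' k, ENNReal.ofReal (|M k j| * ω'' k) :=
        tsum_congr fun j => ENNReal.tsum_mul_left
    _ ≤ ∑' j, ENNReal.ofReal |N j m| * ENNReal.ofReal (C₂ * ω' j) :=
        ENNReal.tsum_le_tsum fun j => mul_le_mul' le_rfl (hM j)
    _ = ∑' j, ENNReal.ofReal C₂ * ENNReal.ofReal (|N j m| * ω' j) := by
        refine tsum_congr fun j => ?_
        rw [← ENNReal.ofReal_mul (abs_nonneg _), ← ENNReal.ofReal_mul hC₂]
        congr 1; ring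
    _ = ENNReal.ofReal C₂ * ∑' j, ENNReal.ofReal (|N j m| * ω' j) := ENNReal.tsum_mul_left
    _ ≤ ENNReal.ofReal C₂ * ENNReal.ofReal (C₁ * ω m) := mul_le_mul' le_rfl (hN m)
    _ = ENNReal.ofReal (C₂ * C₁ * ω m) := by
        rw [← ENNReal.ofReal_mul hC₂]; congr 1; ring

/-- **`T_{M ∘ₖ N} = T_M ∘ T_N` on `ℓ¹_ω`** (Fubini): under the two column bounds and positive
middle / target weights, for `s ∈ ℓ¹_ω` the double series `Σ_{j,m} M(k,j) N(j,m) s_m` converges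
absolutely for every row `k`, so applying the composite kernel is applying `N` then `M`.
[cite: HungriaLessardMirelesJames2016, §5.2 (5.13) p. 1453] -/
theorem apply_kerComp (hω : ∀ i, 0 ≤ ω i) (hω' : ∀ j, 0 < ω' j) (hω'' : ∀ k, 0 < ω'' k)
    {M : ι'' → ι' → ℝ} {N : ι' → ι → ℝ} {C₁ C₂ : ℝ} (hC₁ : 0 ≤ C₁) (hC₂ : 0 ≤ C₂)
    (hN : ColBound ω ω' N C₁) (hM : ColBound ω' ω'' M C₂) {s : ι → ℝ} (hs : Mem ω s) :
    apply (kerComp M N) s = apply M (apply N s) := by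
  have hω'0 : ∀ j, 0 ≤ ω' j := fun j => (hω' j).le
  funext k
  have hωk : 0 < ω'' k := hω'' k
  -- the dominating family g (m, j) = (C₂ / ω'' k) · |s m| · (|N j m| ω' j) is summable
  set g : ι × ι' → ℝ := fun p => C₂ / ω'' k * (|s p.1| * (|N p.2 p.1| * ω' p.2)) with hg
  have hg0 : 0 ≤ g := fun p => by
    simp only [hg]
    exact mul_nonneg (div_nonneg hC₂ hωk.le)
      (mul_nonneg (abs_nonneg _) (mul_nonneg (abs_nonneg _) (hω'0 _)))
  have hcol : ∀ m, (Summable fun j => |N j m| * ω' j) ∧ ∑' j, |N j m| * ω' j ≤ C₁ * ω m :=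
    fun m => col_summable_and_le hω'0 hN m (mul_nonneg hC₁ (hω m))
  have hgs : Summable g := by
    refine (summable_prod_of_nonneg hg0).2 ⟨fun m => ?_, ?_⟩
    · exact ((hcol m).1.mul_left (|s m|)).mul_left (C₂ / ω'' k)
    · simp only [hg]
      have hb : ∀ m, ∑' j, C₂ / ω'' k * (|s m| * (|N j m| * ω' j)) ≤
          C₂ / ω'' k * C₁ * (|s m| * ω m) := by
        intro m
        rw [tsum_mul_left, tsum_mul_left]
        calc C₂ / ω'' k * (|s m| * ∑' j, |N j m| * ω' j)
            ≤ C₂ / ω'' k * (|s m| * (C₁ * ω m)) :=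
              mul_le_mul_of_nonneg_left
                (mul_le_mul_of_nonneg_left (hcol m).2 (abs_nonneg _)) (div_nonneg hC₂ hωk.le)
          _ = C₂ / ω'' k * C₁ * (|s m| * ω m) := by ring
      refine Summable.of_nonneg_of_le (fun m => ?_) hb ((hs.mul_left _))
      rw [tsum_mul_left, tsum_mul_left]
      exact mul_nonneg (div_nonneg hC₂ hωk.le)
        (mul_nonneg (abs_nonneg _) (tsum_nonneg fun j => mul_nonneg (abs_nonneg _) (hω'0 j)))
  -- the actual family F (m, j) = M k j N j m s m is dominated by g
  have hF : Summable fun p : ι × ι' => M k p.2 * N p.2 p.1 * s p.1 := by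
    refine Summable.of_norm_bounded hgs fun p => ?_
    rw [Real.norm_eq_abs, abs_mul, abs_mul]
    have hkj : |M k p.2| * ω'' k ≤ C₂ * ω' p.2 := abs_entry_mul_weight_le hω'0 hC₂ hM k p.2
    have hkj' : |M k p.2| ≤ C₂ / ω'' k * ω' p.2 := by
      rw [div_mul_eq_mul_div, le_div_iff₀ hωk]; exact hkj
    simp only [hg]
    calc |M k p.2| * |N p.2 p.1| * |s p.1|
        ≤ C₂ / ω'' k * ω' p.2 * |N p.2 p.1| * |s p.1| := by
          gcongr
      _ = C₂ / ω'' k * (|s p.1| * (|N p.2 p.1| * ω' p.2)) := by ring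
  unfold apply kerComp
  calc ∑' m, (∑' j, M k j * N j m) * s m = ∑' m, ∑' j, M k j * N j m * s m := by
        refine tsum_congr fun m => ?_
        rw [← tsum_mul_right]
    _ = ∑' j, ∑' m, M k j * N j m * s m := (hF.tsum_comm).symm
    _ = ∑' j, M k j * ∑' m, N j m * s m := by
        refine tsum_congr fun j => ?_
        rw [← tsum_mul_left]
        refine tsum_congr fun m => ?_
        ring

end Composition

/-! ### 2. The identity kernel and the `Z₁` kernel `I − A·M` -/

section OneSub

variable {ω : ι → ℝ} {ω' : ι' → ℝ}

/-- The identity kernel `[k = m]`. [folklore] -/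
def idKer [DecidableEq ι] (k m : ι) : ℝ := if k = m then 1 else 0

/-- `T_{id} s = s` (the identity operator `I` of `[I − AA†]c`).
[cite: HungriaLessardMirelesJames2016, §5.2 (5.13) p. 1453] -/
theorem apply_idKer [DecidableEq ι] (s : ι → ℝ) : apply idKer s = s := by
  funext k
  unfold apply
  rw [tsum_eq_single k fun m hm => by simp [idKer, Ne.symm hm]]
  simp [idKer]

/-- The **`Z₁` kernel** `I − A·M` of a Newton-like / radii-polynomial certificate
(`A : ℓ¹_{ω'} → ℓ¹_ω` the approximate inverse, `M : ℓ¹_ω → ℓ¹_{ω'}` the linearisation or `A†`).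
[cite: HungriaLessardMirelesJames2016, §5.2 (5.13)–(5.14) p. 1453] -/
def oneSubKer [DecidableEq ι] (A : ι → ι' → ℝ) (M : ι' → ι → ℝ) (k m : ι) : ℝ :=
  idKer k m - kerComp A M k m

/-- `T_{I − A·M} s = s − T_A (T_M s)` for `s ∈ ℓ¹_ω` (under the column bounds, positive weights).
[cite: HungriaLessardMirelesJames2016, §5.2 (5.13) p. 1453] -/
theorem apply_oneSubKer [DecidableEq ι] (hω : ∀ i, 0 < ω i) (hω' : ∀ j, 0 < ω' j)
    {A : ι → ι' → ℝ} {M : ι' → ι → ℝ} {C₁ C₂ : ℝ} (hC₁ : 0 ≤ C₁) (hC₂ : 0 ≤ C₂)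
    (hM : ColBound ω ω' M C₁) (hA : ColBound ω' ω A C₂) {s : ι → ℝ} (hs : Mem ω s) :
    apply (oneSubKer A M) s = s - apply A (apply M s) := by
  have hω0 : ∀ i, 0 ≤ ω i := fun i => (hω i).le
  rw [← apply_kerComp hω0 hω' hω hC₁ hC₂ hM hA hs]
  funext k
  have h1 : Summable fun m => kerComp A M k m * s m :=
    summable_apply_row hω0 hω (mul_nonneg hC₂ hC₁) (colBound_kerComp hω0 hC₂ hM hA) hs k
  have h2 : Summable fun m => idKer k m * s m :=
    summable_of_ne_finset_zero (s := {k}) fun m hm => by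
      rw [Finset.mem_singleton] at hm
      simp [idKer, Ne.symm hm]
  simp only [Pi.sub_apply, apply, oneSubKer]
  have e : (fun m => (idKer k m - kerComp A M k m) * s m) =
      fun m => idKer k m * s m - kerComp A M k m * s m := by
    funext m; ring
  rw [e, h2.tsum_sub h1]
  congr 1
  rw [tsum_eq_single k fun m hm => by simp [idKer, Ne.symm hm]]
  simp [idKer]

/-- **A column bound `Z` of the `Z₁` kernel is the operator estimate `‖s − A(M s)‖_ω ≤ Z ‖s‖_ω`**
(the form in which `Z` enters the contraction / radii-polynomial theorems).
[cite: HungriaLessardMirelesJames2016, §5.2 (5.14) p. 1453] -/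
theorem wnorm_sub_apply_apply_le [DecidableEq ι] (hω : ∀ i, 0 < ω i) (hω' : ∀ j, 0 < ω' j)
    {A : ι → ι' → ℝ} {M : ι' → ι → ℝ} {C₁ C₂ Z : ℝ} (hC₁ : 0 ≤ C₁) (hC₂ : 0 ≤ C₂) (hZ0 : 0 ≤ Z)
    (hM : ColBound ω ω' M C₁) (hA : ColBound ω' ω A C₂) (hZ : ColBound ω ω (oneSubKer A M) Z)
    {s : ι → ℝ} (hs : Mem ω s) :
    Mem ω (s - apply A (apply M s)) ∧ wnorm ω (s - apply A (apply M s)) ≤ Z * wnorm ω s := by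
  have hω0 : ∀ i, 0 ≤ ω i := fun i => (hω i).le
  rw [← apply_oneSubKer hω hω' hC₁ hC₂ hM hA hs]
  exact wnorm_apply_le hω0 hω0 hZ0 hZ hs

/-! #### Block-diagonal left factor -/

/-- **`A·M` for a block-diagonal `A = A_K ⊕ diag(d)`** (no convergence question: every row of `A`
is finitely supported): on a block row `k ∈ S` it is the finite loop `Σ_{j∈S} A_K(k,j) M(j,m)`, on a
tail row `k ∉ S` it is `d(k) M(k,m)`. [cite: HungriaLessardMirelesJames2016, Cor. 1 p. 1434] -/
theorem kerComp_blockDiag [DecidableEq ι] (S : Finset ι) (AK : ι → ι → ℝ) (d : ι → ℝ)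
    (M : ι → ι' → ℝ) (k : ι) (m : ι') :
    kerComp (blockDiag S AK d) M k m =
      if k ∈ S then ∑ j ∈ S, AK k j * M j m else d k * M k m := by
  unfold kerComp
  by_cases hk : k ∈ S
  · rw [if_pos hk]
    rw [tsum_eq_sum (s := S) fun j hj => by simp [blockDiag, hj, ne_of_mem_of_not_mem hk hj]]
    refine Finset.sum_congr rfl fun j hj => ?_
    simp [blockDiag, hj, hk]
  · rw [if_neg hk]
    rw [tsum_eq_single k fun j hj => ?_]
    · simp [blockDiag, hk]
    · by_cases hjS : j ∈ S
      · simp [blockDiag, hjS, hk]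
      · simp [blockDiag, hjS, Ne.symm hj]

/-- If column `m` of `M` VANISHES on the block rows `S` (the situation of every column beyond the
bandwidth of a banded `M`: "the diagonal tail of `I − AA†` is zero",
[HungriaLessardMirelesJames2016, p. 1453]), then `(A·M)(k,m) = d(k) M(k,m)` off `S` and `0` on `S`:
the finite block never sees that column. [cite: HungriaLessardMirelesJames2016, §5.2 p. 1453] -/
theorem kerComp_blockDiag_of_col_vanish [DecidableEq ι] (S : Finset ι) (AK : ι → ι → ℝ)
    (d : ι → ℝ) {M : ι → ι → ℝ} {m : ι} (hcol : ∀ j ∈ S, M j m = 0) (k : ι) :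
    kerComp (blockDiag S AK d) M k m = if k ∈ S then 0 else d k * M k m := by
  rw [kerComp_blockDiag]
  by_cases hk : k ∈ S
  · rw [if_pos hk, if_pos hk]
    exact Finset.sum_eq_zero fun j hj => by rw [hcol j hj, mul_zero]
  · rw [if_neg hk, if_neg hk]

/-- **Far-column lemma.**  Let `A = A_K ⊕ diag(d)` and let `m ∉ S` be a column of `M` that vanishes
on the block rows `S`, of the form `M(k,m) = μ [k = m] + R(k,m)` off `S` with `d(m) μ = 1` (the
diagonal tail of `A` inverts the symbol `μ` of that column) and `|d(k)| ≤ δ` wherever `R(k,m) ≠ 0`.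
Then column `m` of `I − A·M` equals `−d(k) R(k,m)` and its weighted norm is at most
`δ · Σ_k |R(k,m)| ω(k) ≤ δ · C_R · ω(m)`.  (HLM2016 p. 1454: the tail rows of `I − A·DF` are the
lower-order operator divided by the symbol, `… / |μ_m|`; here `δ` may vary with the column class
and `R` may carry `k`-dependent factors.) [cite: HungriaLessardMirelesJames2016, §5.2 p. 1453–1454] -/
theorem far_column_tsum_le [DecidableEq ι] (hω : ∀ i, 0 ≤ ω i) (S : Finset ι) (AK : ι → ι → ℝ)
    (d : ι → ℝ) {M R : ι → ι → ℝ} {m : ι} {μ δ CR : ℝ} (hm : m ∉ S)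
    (hcol : ∀ j ∈ S, M j m = 0) (hsplit : ∀ k, k ∉ S → M k m = (if k = m then μ else 0) + R k m)
    (hμ : d m * μ = 1) (hδ0 : 0 ≤ δ) (hδ : ∀ k, k ∉ S → R k m ≠ 0 → |d k| ≤ δ)
    (hR : (Summable fun k => |R k m| * ω k) ∧ ∑' k, |R k m| * ω k ≤ CR * ω m) :
    (Summable fun k => |oneSubKer (blockDiag S AK d) M k m| * ω k) ∧
      ∑' k, |oneSubKer (blockDiag S AK d) M k m| * ω k ≤ δ * CR * ω m := by
  have hentry : ∀ k, |oneSubKer (blockDiag S AK d) M k m| * ω k ≤ δ * (|R k m| * ω k) := by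
    intro k
    unfold oneSubKer
    rw [kerComp_blockDiag_of_col_vanish S AK d hcol k]
    by_cases hk : k ∈ S
    · have hkm : k ≠ m := fun h => hm (h ▸ hk)
      rw [if_pos hk]
      simp only [idKer, if_neg hkm, sub_zero, abs_zero, zero_mul]
      exact mul_nonneg hδ0 (mul_nonneg (abs_nonneg _) (hω k))
    · rw [if_neg hk, hsplit k hk]
      by_cases hkm : k = m
      · have hdk : d k * μ = 1 := by rw [hkm]; exact hμ
        simp only [idKer, if_pos hkm]
        have e : (1 : ℝ) - d k * (μ + R k m) = -(d k * R k m) := by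
          linear_combination -hdk
        rw [e, abs_neg, abs_mul]
        by_cases hR0 : R k m = 0
        · simp [hR0]
        · calc |d k| * |R k m| * ω k = |d k| * (|R k m| * ω k) := by ring
            _ ≤ δ * (|R k m| * ω k) :=
              mul_le_mul_of_nonneg_right (hδ k hk hR0) (mul_nonneg (abs_nonneg _) (hω k))
      · simp only [idKer, if_neg hkm, zero_add, zero_sub, abs_neg, abs_mul]
        by_cases hR0 : R k m = 0
        · simp [hR0]
        · calc |d k| * |R k m| * ω k = |d k| * (|R k m| * ω k) := by ring
            _ ≤ δ * (|R k m| * ω k) :=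
              mul_le_mul_of_nonneg_right (hδ k hk hR0) (mul_nonneg (abs_nonneg _) (hω k))
  have hnn : ∀ k, 0 ≤ |oneSubKer (blockDiag S AK d) M k m| * ω k :=
    fun k => mul_nonneg (abs_nonneg _) (hω k)
  have hsum : Summable fun k => |oneSubKer (blockDiag S AK d) M k m| * ω k :=
    (hR.1.mul_left δ).of_nonneg_of_le hnn hentry
  refine ⟨hsum, ?_⟩
  calc ∑' k, |oneSubKer (blockDiag S AK d) M k m| * ω k
      ≤ ∑' k, δ * (|R k m| * ω k) := hsum.tsum_le_tsum hentry (hR.1.mul_left δ)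
    _ = δ * ∑' k, |R k m| * ω k := tsum_mul_left
    _ ≤ δ * (CR * ω m) := mul_le_mul_of_nonneg_left hR.2 hδ0
    _ = δ * CR * ω m := by ring

/-- **Assembling a column bound from an enumerated set of columns and a uniform far bound**: if
every column `m ∈ T` has been checked (exactly / by intervals) to have weighted sum `≤ Z ω(m)` and
every column `m ∉ T` satisfies the same inequality by a tail lemma, then `ColBound ω ω' X Z`, hence
`‖T_X‖ ≤ Z` by `wnorm_apply_le`.  (`Z = max(Z_block, Z_tail, Z_far)`-type bookkeeping.)
[cite: HungriaLessardMirelesJames2016, Cor. 1 p. 1434] -/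
theorem colBound_of_split (hω' : ∀ k, 0 ≤ ω' k) {X : ι' → ι → ℝ} {Z : ℝ} (T : Finset ι)
    (hT : ∀ m ∈ T, (Summable fun k => |X k m| * ω' k) ∧ ∑' k, |X k m| * ω' k ≤ Z * ω m)
    (hfar : ∀ m, m ∉ T → (Summable fun k => |X k m| * ω' k) ∧ ∑' k, |X k m| * ω' k ≤ Z * ω m) :
    ColBound ω ω' X Z := by
  refine colBound_of_tsum_le hω' fun m => ?_
  by_cases hm : m ∈ T
  · exact hT m hm
  · exact hfar m hm

/-- A finitely supported column: its weighted series is the finite loop over the support — the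
finite column sums `Σ_{|k|<m} |A_{k,n}| ν^{|k|}` of the source's constant `K`, for any index and
weight (what an implementation evaluates for the enumerated columns).
[cite: HungriaLessardMirelesJames2016, Cor. 1 (2.3) p. 1434] -/
theorem col_tsum_of_support {ω' : ι' → ℝ} {X : ι' → ι → ℝ} {m : ι} (Sk : Finset ι')
    (hS : ∀ k, k ∉ Sk → X k m = 0) :
    (Summable fun k => |X k m| * ω' k) ∧ ∑' k, |X k m| * ω' k = ∑ k ∈ Sk, |X k m| * ω' k := by
  have hz : ∀ k, k ∉ Sk → |X k m| * ω' k = 0 := fun k hk => by rw [hS k hk, abs_zero, zero_mul]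
  exact ⟨summable_of_ne_finset_zero (s := Sk) hz, tsum_eq_sum (s := Sk) hz⟩

end OneSub

end Literature.Analysis.ValidatedNumerics.WeightedSeq

end
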